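import Summits.QuantumFields.YangMills.Theorems.BalabanLadderIRCofinalCouplingsBridge
import Summits.QuantumFields.YangMills.Theorems.BalabanLadderIRCofinalCouplingsSeam
import Summits.QuantumFields.YangMills.Theorems.InfiniteVolumeContinuumOSExistenceOfLegsOn
import Summits.QuantumFields.YangMills.Theorems.BalabanLadderIRColdPurityBridgeRungs
import Summits.QuantumFields.YangMills.Theorems.BalabanLadderIRAbstractBasinRung24
import Summits.QuantumFields.YangMills.Theses.BalabanLadder
import HarnessLib

/-!
# Crux `IR` (stmt-QuantumFields-19354) — line `cofinal-leaf` (ideator ym-ir-idea-12 g2, lens «wuc» applied at the LEAF)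

HONESTY.  Nothing here proves the Yang–Mills mass gap (Clay), the crux `IR`, or the seed; R4 closes only the conditional
finite-𝕋⁴ rung `BalabanLadder.UV`.  This file is a CONDITIONAL REDUCTION with three registered-by-text stubs (K1 = THE
NUMBER `ExitsUnboundedAt (1/24)` — verbatim the K1 of line `coupling-clopen` rev 8; X = `AFToColdPressure` and
N = `IRnsc` BY NAME, the tokens of record); everything else is kernel-checked over four LANDED support files
(p607583 `…CofinalCouplingsGrowth`, p607599 `…CofinalCouplingsRope`, p608948 `…CofinalCouplingsBridge`, p607931
`…CofinalCouplingsSeam`).  IT DOES NOT CONCLUDE `IR` BY NAME — it concludes the SUMMIT's use of `IR`: see «ADMISSIBILITY».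

REV 3 (07:25Z): + §7 bill comparison `exitsUnboundedAt_of_coldExitAt : E(θ) → K1(θ)`, `yangMills_of_EXN` (PROVED).
REV 2 (2026-08-28T07:12Z): the landed cofinal bridge `Y2Bridge.yangMills_of_cofinalLegs` (p608948) is now used BY NAME in `closes_cof`;
rev 1 (48944d150621) carried its exact statement as the hypothesis `CofinalBridge` only while the hub had not yet built that module.

THE LENS («weakest unknown consequence of `IR` usable toward the target») applied where every seed-level re-cut of the
census failed (LENS FLOOR, REDUCTION-CENSUS v3.8: each is K-EQUIV or meets the β-transport wall) — at the LEAF ITSELF.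
Q: what does the spine's deciding theorem `BalabanLadder.closes` actually CONSUME of `IR = ∀ β ≥ β₂, GapInUnits-bound`?
A (read off `Y2Bridge.osDataWithGap_of_legs_germ`, CERTIFIED by the landed re-run `Y2Bridge.yangMills_of_cofinalLegs`):
the `GapInUnits` family of clustering bounds is used ONLY (a) in `stub_growth` step 11 along the volume scheme
`sch.β j = βs (φ j)` where `βs` is an ARBITRARY sequence of couplings above the thresholds, and (b) in `stub_rope`'s
anchor at `β = sch.β k`.  Hence the summit needs the bound only on SOME COFINAL SET OF COUPLINGS (one rate `c₁`,
species-uniform constants):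

  `IRcof` := ∀ simple compact `G`, ∀ `r a`, `a > 0 → a → 0 → LowerBounds G r a →`
             `∃ Bset ⊂ ℝ` unbounded above, the `GapInUnits` family ON `Bset`.

`IRcof` is the weakest consequence of `IR` (`IRcof_of_IR`) that still closes the summit with the other five leaves
UNCHANGED (`closes_cof : UV → UVSeamRec → NT → IRcof → ROT → UVOtherGroups → YangMills`, proved below from the landed
bridge).  And its bill is STRICTLY SHORTER than every bill of record for `IR`:

  `IRcof ⇐ K1 ∧ X ∧ N`,   K1 = `ExitsUnboundedAt (1/24)` (cofinal exits at ONE tolerance), X = `AFToColdPressure`, N = `IRnsc`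

(`IRcof_of`, proved: on simply-connected `G` take `Bset :=` the set of exiting couplings `{β ≥ 0 | ∃ L ≥ 8, δᶜ_β(L) ≤ 1/24}`,
cofinal by K1, and the landed per-β kernel `ColdPressurePincer.gapOn_exitSet_of_af` (abstract basin `1/24 → ε⋆` AT THAT
COUPLING, explicit recursion, cold-pressure seam, AF pincer, rate seam — all per-β, all landed); on the other `G` the token N
gives the bound everywhere).  Compare the bills of record: `IR ⇐ E(1/24) ∧ X ∧ N` with `E(1/24) = ColdExitAt (1/24)` = an exit
at EVERY large coupling (LEAD re-base, `BasinRung.IR_of_exitAt24`), and line `coupling-clopen`: `IR ⇐ K1 ∧ K2 ∧ X ∧ N` with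
K2 = `ExitScaleTameSC` (no bulk criticality accumulating at β = ∞) — the COUPLING-AXIS TRANSPORT WALL (census §F B-POWERLAW /
«β-axis transport»; g0's K2, LIP, M♭ all sit on it).  For the SUMMIT that wall is not load-bearing: `closes_cof` deletes it.
What remains of the Yang–Mills content is K1 in its weakest usable quantifier shape: for every `β₁` ONE coupling `β ≥ β₁`
and ONE cold `4:1` torus with `Z_β(L³×2m) ≥ (23/24) Z_β(L³×m)²` — per instance a single inequality between two
finite-dimensional Haar integrals (Σ₁; FINITE-BOX-PURITY.md v1.3: SU(2) β_W = 2.4, boxes ≈ 40³×{10,20}).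

ADMISSIBILITY (said plainly).  The unit's target is `IR` by token; this line's kernel theorem is `closes_cof` /
`yangMills_of_K1XN`, i.e. it assembles to the SUB-PROBLEM `YangMills` with the spine's other five leaves by name, replacing the
leaf `IR` by the weaker `IRcof`.  Whether the spine RE-TYPES its rank-5 leaf `IR ↦ IRcof` (a `route edit --restate`, glue =
`closes_cof`) is a ROUTE-OWNER decision (director-ym / LEAD), not the ideator's; the line is filed as the evidence for it.
`IRcof → IR` is NOT claimed (it would be the transport wall again).

WHY NOVEL (vs census §L rows 1–29, lines of record, g0's two lines): every row re-cuts the SEED and keeps the leaf; none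
observes that the bridge consumes the leaf only cofinally.  Nearest: `coupling-clopen` (same K1; needs K2) and the LEAD bill
`E(1/24)` (exit at every large β).  Delta in one sentence: the «for all large β» of the leaf is discharged not by topology
on the coupling axis (K2) nor asserted (E) but shown UNNECESSARY for the summit by re-running the OS bridge along couplings
chosen inside the exit set.

BARRIERS.  technique_class: reduction / bookkeeping over the OS-bridge (no new estimate).  B-ENTROPY / C22 (no universal
threshold): respected — tolerance `1/24` and `ε⋆` are the LANDED model-dependent basin constants; B-POWERLAW / β-transport:
EVADED BY DELETION (no statement relates two couplings); AbelianDeconfinementD4 / light fluxes: K1 is false for `U(1)₄` and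
for `π₁ ≠ 1` — any proof of K1 uses non-abelianness and simple-connectedness (N carries the flux half BY NAME); B-PRICE: the
price of K1 is exactly the seed inequality of record at 1/24, cofinally — no new currency is claimed.

DISPROOF USED.  No `Cruxes/IR/Disproof.lean` obstruction bears on the quantifier shape in β (the recorded `_false_without_`
items concern group-blindness and flux sectors: honoured — K1 quantifies over simply-connected simple `G`, N is by name).

CHEAPEST FALSIFIER.  (i) of the reduction: none — kernel-checked; (ii) of K1: the seed inequality at ONE weak coupling
(eng sweep of record; a certified violation `Z(L³×2m) < (23/24) Z(L³×m)²` on all `L ≥ 8` at couplings → ∞ for SU(2) would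
kill K1 and with it every line of the census).
-/

set_option autoImplicit false

noncomputable section

open Filter Topology MeasureTheory
open scoped SchwartzMap
open Literature.MathematicalPhysics.QuantumFieldTheory Literature.MathematicalPhysics.QuantumLattice
open Summit.QuantumFields.YangMills.Cruxes.OSLegsFromFemtoAndGap.DlrCollarTransfer (GapInUnits LowerBounds)
open Summit.QuantumFields.YangMills.Cruxes.IR.ColdPressurePincer
open Summit.QuantumFields.YangMills.Cruxes.IR.ColdPurityBridge (coldDefect)
open Summit.QuantumFields.YangMills.Theses.BalabanLadder (UV UVSeamRec NT IR ROT UVOtherGroups)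

namespace Summit.QuantumFields.YangMills.Cruxes.IR.CofinalLeaf

/-! ## §1 Statements -/

section Defs

variable (G : Type) [Group G] [TopologicalSpace G] [IsTopologicalGroup G] [CompactSpace G]
  [MeasurableSpace G] [BorelSpace G]

/-- **`GapOn G r a Bset` — the `GapInUnits` family of clustering bounds ON THE SET OF COUPLINGS `Bset`** (verbatim the body of
`DlrCollarTransfer.GapInUnits` with the binder `β ∈ Bset →`; `Bset = univ` is `GapInUnits`, `gapOn_univ_iff`). -/
def GapOn (r : LatticeRep G) (a : ℝ → ℝ) (Bset : Set ℝ) : Prop :=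
  ∃ (c₁ β₂ : ℝ) (S₁ : ℝ → ℕ), 0 < c₁ ∧ ∀ A B : YMSpecies G, ∃ C : ℝ, ∀ β ∈ Bset, β₂ ≤ β →
    ∀ S n : ℕ, S₁ β ≤ S → n ≤ S →
      |latticeConnectedCorr r.ρ β (2 * S + 1) A.F B.F n| ≤ C * Real.exp (-(c₁ * a β * n))

end Defs

/-- **`IRcof` — THE COFINAL LEAF (crux shape; the weakest consequence of `IR` the summit consumes).**  For every compact simple
`G`, every `r`, every positive unit map `a → 0` with `LowerBounds G r a`: the `GapInUnits` family holds on SOME set of couplings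
unbounded above.  `IR → IRcof` (`IRcof_of_IR`); `IRcof` closes the summit with the other five leaves (`closes_cof`).
Why it might fail: as `IR` — a massless phase at all large couplings (false for `U(1)₄`; the flux half is N). -/
def IRcof : Prop :=
  ∀ (G : Type) [Group G] [TopologicalSpace G] [IsTopologicalGroup G] [CompactSpace G],
    IsCompactSimpleLieGroup G →
    letI : MeasurableSpace G := borel G
    haveI : BorelSpace G := ⟨rfl⟩
    ∀ (r : LatticeRep G) (a : ℝ → ℝ), (∀ β, 0 < a β) → Tendsto a atTop (𝓝 0) → LowerBounds G r a →
      ∃ Bset : Set ℝ, (∀ x : ℝ, ∃ β ∈ Bset, x ≤ β) ∧ GapOn G r a Bset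

/-- **(K1) `ExitsUnboundedAt θ` — exiting couplings are unbounded at tolerance `θ`** (VERBATIM the K1 of line
`coupling-clopen` rev 8, `CouplingClopen.ExitsUnboundedAt`; restated by text so the two workfiles stay independent modules —
same normalised signature).  For compact simple simply-connected `G` and every `r`: for every `β₁` some coupling `β ≥ β₁` has ONE
cold `4:1` torus of half-side `L ≥ 8` with purity defect `δᶜ_β(L) ≤ θ`.
Why it might fail: a non-abelian massless / deconfined phase `[β_c, ∞)`; FALSE for `U(1)₄` (Guth, Fröhlich–Spencer) and for
`π₁(G) ≠ 1` (light fluxes) — a proof must use non-abelianness and `π₁ = 1`.  Sources: Guth1980; FrohlichSpencer1982;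
tHooft1979; `Literature.Barriers.QuantumFields.AbelianDeconfinementD4`; FINITE-BOX-PURITY.md v1.3. -/
def ExitsUnboundedAt (θ : ℝ) : Prop :=
  ∀ (G : Type) [Group G] [TopologicalSpace G] [IsTopologicalGroup G] [CompactSpace G],
    IsCompactSimpleLieGroup G → SimplyConnectedSpace G →
    letI : MeasurableSpace G := borel G
    haveI : BorelSpace G := ⟨rfl⟩
    ∀ r : LatticeRep G, ∀ β₁ : ℝ, ∃ β : ℝ, β₁ ≤ β ∧ ∃ L : ℕ, 8 ≤ L ∧ coldDefect r.ρ β L ≤ θ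

/-! ## §2 The stubs (K1 = the number; X, N = tokens of record BY NAME) -/

/-- stub **K1** (crux, rank 2 — THE NUMBER): `ExitsUnboundedAt (1/24)`.  OPEN (body proved on the strong-coupling window
`[0, r_ρ]`: `CouplingClopen.exitsAt_strongCoupling`). -/
theorem stub_K1 : ExitsUnboundedAt (1 / 24) := by
  sorry

/-- stub **X** (token of record, BY NAME): `ColdPressurePincer.AFToColdPressure`. -/
theorem stub_X : AFToColdPressure := by
  sorry

/-- stub **N** (residual of record, BY NAME): `ColdPressurePincer.IRnsc`. -/
theorem stub_N : IRnsc := by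
  sorry

/-! ## §3 Bookkeeping: `GapOn` vs `GapInUnits`; `IR → IRcof` -/

section Book

variable {G : Type} [Group G] [TopologicalSpace G] [IsTopologicalGroup G] [CompactSpace G]
  [MeasurableSpace G] [BorelSpace G]

theorem gapOn_univ_iff (r : LatticeRep G) (a : ℝ → ℝ) : GapOn G r a Set.univ ↔ GapInUnits G r a := by
  constructor
  · rintro ⟨c₁, β₂, S₁, hc₁, hC⟩
    refine ⟨c₁, β₂, S₁, hc₁, fun A B => ?_⟩
    obtain ⟨C, hC'⟩ := hC A B
    exact ⟨C, fun β hβ S n hS hn => hC' β (Set.mem_univ β) hβ S n hS hn⟩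
  · rintro ⟨c₁, β₂, S₁, hc₁, hC⟩
    refine ⟨c₁, β₂, S₁, hc₁, fun A B => ?_⟩
    obtain ⟨C, hC'⟩ := hC A B
    exact ⟨C, fun β _ hβ S n hS hn => hC' β hβ S n hS hn⟩

theorem gapOn_mono (r : LatticeRep G) (a : ℝ → ℝ) {B₁ B₂ : Set ℝ} (h : B₁ ⊆ B₂) (hB : GapOn G r a B₂) :
    GapOn G r a B₁ := by
  obtain ⟨c₁, β₂, S₁, hc₁, hC⟩ := hB
  refine ⟨c₁, β₂, S₁, hc₁, fun A B => ?_⟩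
  obtain ⟨C, hC'⟩ := hC A B
  exact ⟨C, fun β hβ hβ2 S n hS hn => hC' β (h hβ) hβ2 S n hS hn⟩

theorem univ_cofinal : ∀ x : ℝ, ∃ β ∈ (Set.univ : Set ℝ), x ≤ β := fun x => ⟨x, Set.mem_univ x, le_rfl⟩

end Book

/-- `IR → IRcof` (take all couplings). -/
theorem IRcof_of_IR (h : IR) : IRcof := by
  intro G _ _ _ _ hG
  letI : MeasurableSpace G := borel G
  haveI : BorelSpace G := ⟨rfl⟩
  intro r a ha ha0 hlb
  exact ⟨Set.univ, univ_cofinal, (gapOn_univ_iff r a).2 (h G hG r a ha ha0 hlb)⟩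

/-! ## §4 The composition, PROVED: K1 ∧ X ∧ N ⇒ `IRcof` (per-β, no coupling-axis transport) -/

/-- **`IRcof` from K1, X, N.**  Simply-connected `G`: `Bset :=` the exit set `{β ≥ 0 | ∃ L ≥ 8, δᶜ_β(L) ≤ 1/24}` — cofinal by
K1, and the landed per-β kernel `ColdPressurePincer.gapOn_exitSet_of_af` gives the family on it; other simple `G`: N gives
`GapInUnits`, i.e. the family on `univ`. -/
theorem IRcof_of (hK1 : ExitsUnboundedAt (1 / 24)) (hX : AFToColdPressure) (hN : IRnsc) : IRcof := by
  intro G _ _ _ _ hG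
  letI : MeasurableSpace G := borel G
  haveI : BorelSpace G := ⟨rfl⟩
  intro r a ha ha0 hlb
  by_cases hsc : SimplyConnectedSpace G
  · refine ⟨{β : ℝ | 0 ≤ β ∧ ∃ L : ℕ, 8 ≤ L ∧ coldDefect r.ρ β L ≤ 1 / 24}, fun x => ?_,
      gapOn_exitSet_of_af hX G hG r a ha ha0 hlb⟩
    obtain ⟨β, hβ, L, hL, hδ⟩ := hK1 G hG hsc r (max x 0)
    exact ⟨β, ⟨le_trans (le_max_right _ _) hβ, L, hL, hδ⟩, le_trans (le_max_left _ _) hβ⟩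
  · exact ⟨Set.univ, univ_cofinal, (gapOn_univ_iff r a).2 (hN G hG hsc r a ha ha0 hlb)⟩

/-- Proof-of-item shape: `IRcof` from the three stubs. -/
theorem IRcof_of_stubs : IRcof := IRcof_of stub_K1 stub_X stub_N

/-! ## §5 The summit from the cofinal leaf (the spine's `closes` with `IR ↦ IRcof`), PROVED over the landed bridge -/

/-- **`closes_cof` — the deciding theorem of the spine with the leaf `IR` replaced by `IRcof`** (same five other leaves BY NAME;
proof = `BalabanLadder.closes` with `Y2Bridge.yangMills_of_legs ↦ Y2Bridge.yangMills_of_cofinalLegs`; the unit map of record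
`u β = exp (sizeLog β 1)` and its decay `InfiniteVolumeContinuum.tendsto_exp_sizeLog_one_nhds_zero`). -/
theorem closes_cof (hUV : UV) (hSeam : UVSeamRec) (hNT : NT) (hIRc : IRcof) (hROT : ROT) (hOther : UVOtherGroups) :
    YangMills := by
  have hu : ∀ β : ℝ, 0 < Real.exp (Summit.QuantumFields.YangMills.Theorems.FemtoTransferGap.sizeLog β 1) :=
    fun β => Real.exp_pos _
  have hu0 := Summit.QuantumFields.YangMills.Theorems.InfiniteVolumeContinuum.tendsto_exp_sizeLog_one_nhds_zero
  refine Summit.QuantumFields.YangMills.Cruxes.OSLegsAtWeakCouplingC.Y2Bridge.yangMills_of_cofinalLegs ?_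
  intro G _ _ _ _ hG
  by_cases hcl : Nonempty (G ≃ₜ* Matrix.specialUnitaryGroup (Fin 2) ℂ)
  · obtain ⟨r, hlb, hmb⟩ := hSeam hUV G hG hcl
    exact ⟨r, _, hu, hu0, hmb, hlb, hIRc G hG r _ hu hu0 hlb, hROT G hG r _ hu hu0 hlb hmb⟩
  · obtain ⟨r, a, ha, ha0, hlb⟩ := hNT G hG
    have hmb := hOther G hG (not_nonempty_iff.mp hcl) r a ha ha0 hlb
    exact ⟨r, a, ha, ha0, hmb, hlb, hIRc G hG r a ha ha0 hlb, hROT G hG r a ha ha0 hlb hmb⟩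

/-- **The summit's bill through this line**: the spine's five other leaves BY NAME and `K1 ∧ X ∧ N` in place of `IR` —
no `E(1/24)` at every coupling, no `ExitScaleTameSC`, no `DefectLipschitzSC`. -/
theorem yangMills_of_K1XN (hUV : UV) (hSeam : UVSeamRec) (hNT : NT) (hK1 : ExitsUnboundedAt (1 / 24))
    (hX : AFToColdPressure) (hN : IRnsc) (hROT : ROT) (hOther : UVOtherGroups) : YangMills :=
  closes_cof hUV hSeam hNT (IRcof_of hK1 hX hN) hROT hOther

/-! ## §6 Rung (PROVED, group-blind): K1's body on the strong-coupling window -/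

section Rung

variable {G : Type} [Group G] [TopologicalSpace G] [IsTopologicalGroup G] [CompactSpace G]
  [MeasurableSpace G] [BorelSpace G]

/-- At strong coupling every coupling exits at tolerance `1/24` (Kotecký–Preiss rung of record via the tree's
`coldExit_uniform_of_strongCoupling`; the same fact as `CouplingClopen.exitsAt_strongCoupling`). -/
theorem exitsAt_strongCoupling (r : LatticeRep G) {β : ℝ} (hβ0 : 0 ≤ β)
    (hβ : β ≤ Literature.MathematicalPhysics.QuantumFieldTheory.Balaban1983to89.Missing.strongCouplingRadius r.ρ) :
    ∃ L : ℕ, 8 ≤ L ∧ coldDefect r.ρ β L ≤ 1 / 24 := by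
  obtain ⟨k₁, hk₁, h⟩ :=
    Summit.QuantumFields.YangMills.Cruxes.IR.ColdPurityBridge.coldExit_uniform_of_strongCoupling r
      (show (0 : ℝ) < 1 / 24 by norm_num)
  exact ⟨8 * k₁, by omega, h β hβ0 hβ k₁ le_rfl⟩

end Rung

/-! ## §7 Bill comparison (PROVED): the new seed is weaker BY CONSTRUCTION than the seed of record -/

/-- **`E(θ) ⇒ K1(θ)`**: the seed of record `BasinRung.ColdExitAt θ` (an exit at EVERY coupling beyond a threshold; bill of record
`BasinRung.IR_of_exitAt24 : ColdExitAt (1/24) → AFToColdPressure → IRnsc → IR`) implies this line's seed `ExitsUnboundedAt θ` (exits at an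
UNBOUNDED set of couplings; bill `yangMills_of_K1XN`).  The converse is the coupling-axis transport wall (`ExitScaleTameSC` / `DefectLipschitzSC`
of `Lines/coupling_clopen.lean`, `Lines/lipschitz_chain.lean`) that this line deletes from the SUMMIT's bill. -/
theorem exitsUnboundedAt_of_coldExitAt {θ : ℝ} (h : Summit.QuantumFields.YangMills.Cruxes.IR.BasinRung.ColdExitAt θ) :
    ExitsUnboundedAt θ := by
  intro G _ _ _ _ hG hsc r β₁
  obtain ⟨β₀, hβ₀⟩ := h G hG hsc r
  exact ⟨max β₀ β₁, le_max_right _ _, hβ₀ (max β₀ β₁) (le_max_left _ _)⟩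

/-- The summit's bill of record factors through this line's bill: `E(1/24) ∧ X ∧ N` (with the other five leaves) gives `YangMills` via
`yangMills_of_K1XN ∘ exitsUnboundedAt_of_coldExitAt` — i.e. nothing the spine could use before is lost by the re-typing `IR ↦ IRcof`. -/
theorem yangMills_of_EXN (hUV : UV) (hSeam : UVSeamRec) (hNT : NT)
    (hE : Summit.QuantumFields.YangMills.Cruxes.IR.BasinRung.ColdExitAt (1 / 24)) (hX : AFToColdPressure) (hN : IRnsc) (hROT : ROT)
    (hOther : UVOtherGroups) : YangMills :=
  yangMills_of_K1XN hUV hSeam hNT (exitsUnboundedAt_of_coldExitAt hE) hX hN hROT hOther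

end Summit.QuantumFields.YangMills.Cruxes.IR.CofinalLeaf

end
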